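import Summits.BirchSwinnertonDyer.BirchSwinnertonDyer.Theorems.KimAtThreeDeepLowerS24DeepSelection
import Summits.BirchSwinnertonDyer.Rank1Residual.GaloisImage.KolyvaginBaseRigidityDeep
import HarnessLib

/-!
# Sakamoto's Lemma 5.2 (four classes, three independent) ON THE DEEP Frobenius sub-class
# `frobeniusClassPrimes ρ′ S τ N′`, `ker ρ′ ≤ ker ρ` — the «missing lemma» of the S24-DEEP port
# (route `KimAtThreeKolyvagin`, rung W2; cell `bsd-addord`, seat `bsd-addord-w2-c2` gen 5)

HONEST FRAMING. TOOL theorems of group cohomology / Chebotarev (no definition, no named fact, no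
`sorry`, no class theorem, nothing booked, no mark moved; BSD is not proved by any of this). They
serve the W2 cruxes `DeepLowerAtThree` (19075) / `DeepLowerAtThreeOffKatoStratum` (19679) and their
twins through the flagged port S24-DEEP (`GaloisImage.S24Deep.kolyvaginSystems_freeRankOne_zmod_three_pow_deep`,
FLAG `S24-DEEP-PORT@3`), whose own docstring (`KolyvaginDeepSubclass.lean`) locates the ONLY
non-restrictive use of the prime set in [S24]: Lemma 5.2 / Cor. 5.5, to be «run with
`F′ := ℚ(μ_{3^{m′}}, T′) ⊇ F` in place of `F` — legitimate GIVEN (H.3′)». Cell `b2b-bsdres` (team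
n1011, seat p15) ran Cor. 5.5 (`n ≤ p` classes) on the deep class
(`PrimeChoiceSakamotoDeep.lean`); the FOUR-class form that [S24] Lemma 6.4 — hence the connectedness
of the core graph `𝒳⁰` (Thm. 6.7) and the injectivity half of Thm. 4.4 (1) at a GENERAL core vertex —
consumes was left open on the deep class (this seat's gen-3 census: «the linear-independence deep
variant is the missing lemma»). This file is that lemma, proved exactly as n1011's pinned-class file
(`PrimeChoiceSelectionIndependent.lean` + `PrimeChoiceSakamotoIndependent.lean`) with
`G_F′ = ker ρ′ ⊓ Gal(K̄/K(μ_{N′}))` in place of `G_F`, and (H.3) stated for `G_F′`: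

* §1 = file 1/2 `KimAtThreeDeepLowerS24DeepSelection` (the SELECTION of `γ ∈ G_F′`; imported);
* §2 `exists_mem_frobeniusClassPrimes_notMem_of_selection_deep` — the Chebotarev step on the deep
  class, FACTORED (any finite family of cocycles, any selected `γ ∈ G_F′`): n1011's
  `exists_mem_frobeniusClassPrimes_notMem_forall_localization_ne_zero_deep` Steps 2–4 verbatim;
* §3 `infinite_setOf_mem_frobeniusClassPrimes_localization_ne_zero_of_linearIndependent_deep` and
  **`…_four_deep` = [S24] Lemma 5.2 in Lemma 6.4's form on the deep class**: `c₁, c₂, c₃`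
  `𝔽_p`-independent in `H¹(K, T̄)`, `c₄ ≠ 0` ⟹ infinitely many `𝔮 ∈ frobeniusClassPrimes ρ′ S τ N′`
  with every `loc_𝔮 cⱼ ≠ 0` — LITERALLY the hypothesis `hL52` of n1011's `m = 1` structure theorem
  `CoreRankOne.isFreeRankOneZMod_and_bijective_of_coreRankOne` /
  `KolyvaginCoreGraphConnected.apply_eq_zero_of_apply_core_eq_zero` for a datum with
  `D.primes = frobeniusClassPrimes ρ′ S τ N′`;
* §4 the `E[p]` reading over `ℚ` (`ρ̄_{E,p}` onto, `p` odd; (H.3′) on `G_F′` kept as the displayed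
  binder, discharged for `E`, `p = 3`, `ρ′ = E[3^{k′+1}]`, `N′ = 3^{k′+1}` by the tree theorems
  `hH3_three_pow_of_irr` / `hH3_three_of_towerSurj`).

References: R. Sakamoto, JTNB **36** (2024) 919–946, Lemma 5.1, Lemma 5.2, Remarks 5.3–5.4, Cor. 5.5
(pp. 927–930), Lemma 6.4, Thm. 6.7 (pp. 931–932) [Sakamoto2024]; B. Mazur, K. Rubin, Mem. AMS **799**
(2004), Prop. 3.6.1 (pp. 30–31), §3.5 (H.5) (p. 27) [MazurRubin2004].
-/

set_option autoImplicit false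
-- the Theorems namespace of a single-conjunct summit repeats the summit name by design (D-0017)
set_option linter.dupNamespace false

noncomputable section

open Function Field NumberField IsDedekindDomain Filter Topology
open Literature.NumberTheory.GaloisRepresentations Literature.NumberTheory.GaloisCohomology
open scoped NumberField Pointwise

namespace Summit.BirchSwinnertonDyer.BirchSwinnertonDyer.Theorems.KimAtThreeDeepLowerS24DeepPrimeChoice

open Summit.BirchSwinnertonDyer.Rank1Residual.GaloisImage
open Summit.BirchSwinnertonDyer.Rank1Residual.GaloisImage.PrimeChoice
open Summit.BirchSwinnertonDyer.BirchSwinnertonDyer.Theorems.KimAtThreeDeepLowerS24DeepSelection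


/-! ### §2–§3 Over a number field: the factored Chebotarev step and Lemma 5.2 on the deep class -/

section Global

variable {K : Type} [Field K] [NumberField K] {M : Type} [AddCommGroup M] [TopologicalSpace M]
  [DiscreteTopology M] (ρ : DiscreteGaloisModule K M)
  {M' : Type} [AddCommGroup M'] [TopologicalSpace M'] [DiscreteTopology M']
  (ρ' : DiscreteGaloisModule K M')

/-- **Chebotarev step on the DEEP class, factored** (n1011's
`exists_mem_frobeniusClassPrimes_notMem_forall_localization_ne_zero_deep`, Steps 2–4, for ANY finite
family of cocycles and ANY selected `γ`): if `γ ∈ G_F′` (`ρ′ γ = 1`, `γ ∈ Gal(K̄/K(μ_{N′}))`) has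
`cᵢ(τγ) ∉ (τ − 1)T̄` for every `i`, then outside any finite `T` there is
`𝔮 ∈ frobeniusClassPrimes ρ′ S τ N′` with `loc_𝔮 [cᵢ] ≠ 0` for every `i` (the open set `U ∋ τγ` cut
out by `ρ′`, `μ_{N′}` and the cocycles; a Frobenius in `U` by the tree's proved Chebotarev
`frobenius_dense`; `ρ σ = ρ τ` because `ρ′ σ = ρ′ τ` and `ker ρ′ ≤ ker ρ`; the local criterion).
[cite: Sakamoto2024, Lemma 5.2, proof (pp. 928–929)] [cite: MazurRubin2004, Prop. 3.6.1 proof, pp. 30–31] -/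
theorem exists_mem_frobeniusClassPrimes_notMem_of_selection_deep [Finite M] [Finite M']
    (hker : ∀ u : absoluteGaloisGroup K, ρ' u = 1 → ρ u = 1)
    {N' : ℕ} (hN : N' ≠ 0)
    (S : Set (HeightOneSpectrum (𝓞 K))) (hS : S.Finite) (τ : absoluteGaloisGroup K)
    {ι : Type*} [Finite ι] (c : ι → contOneCocycles ρ.toTopRep)
    {γ : absoluteGaloisGroup K} (hγρ : ρ' γ = 1) (hγμ : γ ∈ rootsOfUnityFixer K N')
    (hγ : ∀ i, (c i).1 (τ * γ) ∉ ((ρ τ).toAddMonoidHom - AddMonoidHom.id M).range)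
    (T : Set (HeightOneSpectrum (𝓞 K))) (hT : T.Finite) :
    ∃ q ∈ frobeniusClassPrimes ρ' S τ N', q ∉ T ∧
      ∀ i, galoisCohomology.localization ρ (Sum.inr q) 1 (oneCocycleClass ρ.toTopRep (c i)) ≠ 0 := by
  classical
  set g₀ : absoluteGaloisGroup K := τ * γ with hg₀
  have hρ'g₀ : ρ' g₀ = ρ' τ := by rw [hg₀, map_mul, hγρ, mul_one]
  -- the open set `U ∋ g₀`
  set U : Set (absoluteGaloisGroup K) :=
    {σ | (∀ m : M', ρ' σ m = ρ' g₀ m) ∧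
      (∀ t : AlgebraicClosure K, t ^ N' = 1 → σ • t = g₀ • t) ∧ ∀ i, (c i).1 σ = (c i).1 g₀}
    with hU_def
  haveI : NeZero N' := ⟨hN⟩
  haveI : NeZero (N' : K) := ⟨Nat.cast_ne_zero.mpr hN⟩
  have hUopen : IsOpen U := by
    have h1 : IsOpen {σ : absoluteGaloisGroup K | ∀ m : M', ρ' σ m = ρ' g₀ m} := by
      have heq : {σ : absoluteGaloisGroup K | ∀ m : M', ρ' σ m = ρ' g₀ m} =
          (fun σ => g₀⁻¹ * σ) ⁻¹' ⋂ m : M', {σ | ρ' σ m = m} := by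
        ext σ
        simp only [Set.mem_setOf_eq, Set.mem_preimage, Set.mem_iInter, map_mul,
          Module.End.mul_apply]
        refine forall_congr' fun m => ⟨fun h => ?_, fun h => ?_⟩
        · rw [h, ← Module.End.mul_apply, ← map_mul, inv_mul_cancel, map_one, Module.End.one_apply]
        · have h' := congrArg (ρ' g₀) h
          rwa [← Module.End.mul_apply, ← map_mul, mul_inv_cancel, map_one, Module.End.one_apply] at h'
      rw [heq]
      exact (isOpen_iInter_of_finite fun m => ρ'.isOpen_setOf_apply_eq m).preimage
        (continuous_const.mul continuous_id)
    have h2 : IsOpen {σ : absoluteGaloisGroup K |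
        ∀ t : AlgebraicClosure K, t ^ N' = 1 → σ • t = g₀ • t} := by
      have heq : {σ : absoluteGaloisGroup K | ∀ t : AlgebraicClosure K, t ^ N' = 1 → σ • t = g₀ • t} =
          (fun σ => g₀⁻¹ * σ) ⁻¹' (rootsOfUnityFixer K N' : Set (absoluteGaloisGroup K)) := by
        ext σ
        simp only [Set.mem_setOf_eq, Set.mem_preimage, SetLike.mem_coe, mem_rootsOfUnityFixer_iff,
          mul_smul, inv_smul_eq_iff]
      rw [heq]
      exact (isOpen_rootsOfUnityFixer K N').preimage (continuous_const.mul continuous_id)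
    have h3 : IsOpen {σ : absoluteGaloisGroup K | ∀ i, (c i).1 σ = (c i).1 g₀} := by
      have heq : {σ : absoluteGaloisGroup K | ∀ i, (c i).1 σ = (c i).1 g₀} =
          ⋂ i, (c i).1 ⁻¹' {(c i).1 g₀} := by
        ext σ; simp [Set.mem_iInter]
      rw [heq]
      exact isOpen_iInter_of_finite fun i => (isOpen_discrete _).preimage (c i).1.continuous
    simpa only [hU_def, Set.setOf_and] using h1.inter (h2.inter h3)
  have hg₀U : g₀ ∈ U := ⟨fun _ => rfl, fun _ _ => rfl, fun _ => rfl⟩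
  -- the finite set of bad places and a Frobenius in `U` away from it
  set B : Set (HeightOneSpectrum (𝓞 K)) :=
    S ∪ T ∪ {v | ((N' : ℕ) : 𝓞 K) ∈ v.asIdeal} ∪ {v | ¬ GaloisRep.IsUnramifiedAt v ρ} ∪
      {v | ¬ GaloisRep.IsUnramifiedAt v ρ'} ∪
      {v | ¬ ∀ i, ∀ 𝔓 ∈ v.primesAbove, ∀ g ∈ 𝔓.inertia (absoluteGaloisGroup K), (c i).1 g = 0}
    with hB_def
  have hBfin : B.Finite := by
    refine ((((hS.union hT).union (finite_setOf_natCast_mem (K := K) (m := N'))).union ?_).union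
      ?_).union ?_
    · exact eventually_cofinite.1 (eventually_isUnramifiedAt ρ)
    · exact eventually_cofinite.1 (eventually_isUnramifiedAt ρ')
    · exact eventually_cofinite.1
        (eventually_all.2 fun i => eventually_forall_inertia_apply_eq_zero ρ (c i))
  have hdense := absoluteGaloisGroup.frobenius_dense
    Literature.NumberTheory.Automorphic.chebotarev_artinRep_of_galoisSide K B hBfin
  obtain ⟨σ, ⟨v, hvB, 𝔓, h𝔓, hσ𝔓⟩, hσU⟩ := hdense.exists_mem_open hUopen ⟨g₀, hg₀U⟩
  simp only [hB_def, Set.mem_union, Set.mem_setOf_eq, not_or, not_not] at hvB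
  obtain ⟨⟨⟨⟨⟨hvS, hvT⟩, hvN⟩, hunr⟩, hunr'⟩, hcI⟩ := hvB
  obtain ⟨hσρ, hσμ, hσc⟩ := hσU
  have hρ'σ : ρ' σ = ρ' τ := (LinearMap.ext hσρ).trans hρ'g₀
  have hρσ : ρ σ = ρ τ := by
    have h1 : ρ' (σ * τ⁻¹) = 1 := by rw [map_mul, hρ'σ, ← map_mul, mul_inv_cancel, map_one]
    have h2 := hker _ h1
    have h3 : ρ (σ * τ⁻¹) * ρ τ = 1 * ρ τ := congrArg (· * ρ τ) h2
    rwa [← map_mul, inv_mul_cancel_right, one_mul] at h3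
  -- `v ∈ 𝒫′` and the localisations are non-zero
  refine ⟨v, ⟨hvS, hvN, hunr', σ, ⟨𝔓, h𝔓, hσ𝔓⟩, fun m => ?_, fun ζ hζ => ?_⟩, hvT, fun i => ?_⟩
  · rw [map_mul, hρ'σ, ← map_mul, mul_inv_cancel, map_one, Module.End.one_apply]
  · have hζ' : (τ⁻¹ • ζ) ^ N' = 1 := by rw [← smul_pow', hζ, smul_one]
    rw [mul_smul, hσμ _ hζ', hg₀, mul_smul, (mem_rootsOfUnityFixer_iff.mp hγμ) _ hζ',
      smul_inv_smul]
  · rw [Ne, localization_oneCocycleClass_eq_zero_iff_of_isArithFrobAt ρ v hunr (c i) (hcI i) h𝔓 hσ𝔓,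
      hσc i, hρσ]
    exact hγ i

/-- **Lemma 5.2, selection + Chebotarev, for an independent family plus one class, ON THE DEEP
CLASS.** `K` a number field, `ρ` a finite discrete `Γ_K`-module `T̄` with (H.1), an auxiliary finite
`ρ′` with `ker ρ′ ≤ ker ρ`, (H.3) on `G_F′ = ker ρ′ ⊓ Gal(K̄/K(μ_{N′}))`, `τ` with `T̄/(τ − 1)T̄ ≃ ℤ/p`,
`p ≥ 3`, `N′ ≠ 0`, `S` finite, classes `cᵢ ∈ H¹(K, T̄)` `𝔽_p`-LINEARLY INDEPENDENT and one more class
`c′ ≠ 0`: **infinitely many `𝔮 ∈ frobeniusClassPrimes ρ′ S τ N′` have `loc_𝔮 cᵢ ≠ 0` for every `i`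
and `loc_𝔮 c′ ≠ 0`.** [cite: Sakamoto2024, Lemma 5.2 (p. 928) and Lemma 6.4 (pp. 931–932)]
[cite: MazurRubin2004, Prop. 3.6.1 (pp. 30–31) and §3.5 (H.5) (p. 27)] -/
theorem infinite_setOf_mem_frobeniusClassPrimes_localization_ne_zero_of_linearIndependent_deep
    [Finite M] [Finite M']
    (hker : ∀ u : absoluteGaloisGroup K, ρ' u = 1 → ρ u = 1)
    {p : ℕ} [Fact p.Prime] (hp : 3 ≤ p) {N' : ℕ} (hN : N' ≠ 0)
    (S : Set (HeightOneSpectrum (𝓞 K))) (hS : S.Finite)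
    {τ : absoluteGaloisGroup K} (hτ : Nonempty (cokerSubOne ρ τ ≃+ ZMod p))
    (hirr : ∀ A : AddSubgroup M,
      (∀ (s : absoluteGaloisGroup K), ∀ m ∈ A, ρ s m ∈ A) → A = ⊥ ∨ A = ⊤)
    (hH3 : ∀ f : contOneCocycles ρ.toTopRep,
      (∀ u : absoluteGaloisGroup K, ρ' u = 1 → u ∈ rootsOfUnityFixer K N' → f.1 u = 0) →
        oneCocycleClass ρ.toTopRep f = 0)
    {ι : Type*} [Fintype ι] [DecidableEq ι] (c : ι → galoisCohomology ρ 1)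
    (hind : ∀ a : ι → ZMod p, (∑ i, (a i).val • c i) = 0 → a = 0)
    (c' : galoisCohomology ρ 1) (hc' : c' ≠ 0) :
    {q | q ∈ frobeniusClassPrimes ρ' S τ N' ∧
      (∀ i, galoisCohomology.localization ρ (Sum.inr q) 1 (c i) ≠ 0) ∧
      galoisCohomology.localization ρ (Sum.inr q) 1 c' ≠ 0}.Infinite := by
  classical
  choose φ hφ using fun i => oneCocycleClass_surjective ρ.toTopRep (c i)
  obtain ⟨φ', hφ'⟩ := oneCocycleClass_surjective ρ.toTopRep c'
  have hcφ : c = fun i => (oneCocycleClass ρ.toTopRep (φ i) : galoisCohomology ρ 1) :=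
    funext fun i => (hφ i).symm
  subst hcφ
  have hindφ : ∀ a : ι → ZMod p, (∑ i, (a i).val • oneCocycleClass ρ.toTopRep (φ i)) = 0 → a = 0 :=
    fun a ha => hind a ha
  have hφ'ne : oneCocycleClass ρ.toTopRep φ' ≠ 0 := by rw [hφ']; exact hc'
  -- §1: the selection for the family `φ` and the extra cocycle `φ′`, packaged on `Option ι`
  obtain ⟨γ, hγρ, hγμ, hγ, hγ'⟩ :=
    exists_forall_apply_mul_notMem_range_of_linearIndependent_deep hp hker hτ.some hirr hH3 φ hindφ φ'
      hφ'ne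
  let d : Option ι → contOneCocycles ρ.toTopRep := fun o => o.elim φ' φ
  have hγd : ∀ o, (d o).1 (τ * γ) ∉ ((ρ τ).toAddMonoidHom - AddMonoidHom.id M).range := by
    intro o
    cases o with
    | none => exact hγ'
    | some i => exact hγ i
  intro hfin
  obtain ⟨q, hq, hqT, hloc⟩ :=
    exists_mem_frobeniusClassPrimes_notMem_of_selection_deep ρ ρ' hker hN S hS τ d hγρ hγμ hγd _ hfin
  exact hqT ⟨hq, fun i => hloc (some i), by rw [← hφ']; exact hloc none⟩

/-- **[S24] Lemma 5.2 at four classes ON THE DEEP CLASS** (the instance Lemma 6.4 consumes: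
`c₁, c₂, c₃` independent, `c₄ ≠ 0` — «`dim_𝔽₃(𝔽₃c₁ + 𝔽₃c₂ + 𝔽₃c₃ + 𝔽₃c₄) ≥ 3`»): infinitely many
`𝔮 ∈ frobeniusClassPrimes ρ′ S τ N′` with `loc_𝔮 cⱼ ≠ 0` for `j = 1, 2, 3, 4` — LITERALLY the
hypothesis `hL52` of n1011's `CoreRankOne.isFreeRankOneZMod_and_bijective_of_coreRankOne` /
`KolyvaginCoreGraphConnected.apply_eq_zero_of_apply_core_eq_zero` when
`D.primes = frobeniusClassPrimes ρ′ S τ N′`.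
[cite: Sakamoto2024, Lemma 5.2 (p. 928), Remark 5.3 and Lemma 6.4 (pp. 928, 931–932)]
[cite: MazurRubin2004, §3.5 (H.5) (p. 27)] -/
theorem infinite_setOf_mem_frobeniusClassPrimes_localization_ne_zero_four_deep [Finite M] [Finite M']
    (hker : ∀ u : absoluteGaloisGroup K, ρ' u = 1 → ρ u = 1)
    {p : ℕ} [Fact p.Prime] (hp : 3 ≤ p) {N' : ℕ} (hN : N' ≠ 0)
    (S : Set (HeightOneSpectrum (𝓞 K))) (hS : S.Finite)
    {τ : absoluteGaloisGroup K} (hτ : Nonempty (cokerSubOne ρ τ ≃+ ZMod p))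
    (hirr : ∀ A : AddSubgroup M,
      (∀ (s : absoluteGaloisGroup K), ∀ m ∈ A, ρ s m ∈ A) → A = ⊥ ∨ A = ⊤)
    (hH3 : ∀ f : contOneCocycles ρ.toTopRep,
      (∀ u : absoluteGaloisGroup K, ρ' u = 1 → u ∈ rootsOfUnityFixer K N' → f.1 u = 0) →
        oneCocycleClass ρ.toTopRep f = 0)
    (c₁ c₂ c₃ c₄ : galoisCohomology ρ 1)
    (hind : ∀ a : Fin 3 → ZMod p, (∑ i, (a i).val • ![c₁, c₂, c₃] i) = 0 → a = 0) (hc₄ : c₄ ≠ 0) :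
    {q | q ∈ frobeniusClassPrimes ρ' S τ N' ∧ galoisCohomology.localization ρ (Sum.inr q) 1 c₁ ≠ 0 ∧
      galoisCohomology.localization ρ (Sum.inr q) 1 c₂ ≠ 0 ∧
      galoisCohomology.localization ρ (Sum.inr q) 1 c₃ ≠ 0 ∧
      galoisCohomology.localization ρ (Sum.inr q) 1 c₄ ≠ 0}.Infinite := by
  classical
  refine (infinite_setOf_mem_frobeniusClassPrimes_localization_ne_zero_of_linearIndependent_deep ρ ρ'
    hker hp hN S hS hτ hirr hH3 ![c₁, c₂, c₃] hind c₄ hc₄).mono ?_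
  rintro q ⟨hq, h, h'⟩
  exact ⟨hq, h 0, h 1, h 2, h'⟩

end Global

/-! ### §4 The `E[p]` reading over `ℚ` -/

section Torsion

open WeierstrassCurve Literature.NumberTheory.EllipticCurves

variable (W : WeierstrassCurve ℚ) [W.IsElliptic]

/-- **Lemma 5.2 at four classes for `T̄ = E[p]` ON A DEEP CLASS** (`ρ̄_{E,p}` onto, `p` odd; `ρ′` an
auxiliary finite module with `ker ρ′ ≤ ker ρ_{E[p]}`, e.g. `E[p^{m′}]`; (H.3) on
`G_F′ = ker ρ′ ⊓ Gal(ℚ̄/ℚ(μ_{N′}))` a displayed HYPOTHESIS — for `E`, `p = 3`, `ρ′ = E[3^{k′}·3]`,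
`N′ = 3^{k′+1}` it is the tree theorem `hH3_three_pow_of_irr`): `c₁, c₂, c₃` independent in
`H¹(ℚ, E[p])`, `c₄ ≠ 0` ⟹ infinitely many `𝔮 ∈ frobeniusClassPrimes ρ′ S τ N′` with `loc_𝔮 cⱼ ≠ 0`,
`j = 1, …, 4` — the `hL52` of the `m = 1` structure theorems on a deep-class datum of `E[p]`.
[cite: Sakamoto2024, Lemma 5.2 (p. 928) and Lemma 6.4 (pp. 931–932)] [cite: MazurRubin2004, Prop. 3.6.1 and §3.5 (H.5)] -/
theorem infinite_setOf_mem_frobeniusClassPrimes_localization_ne_zero_torsion_four_deep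
    (p : ℕ) [Fact p.Prime] (hp2 : p ≠ 2) (hsurj : W.HasSurjectiveModNGaloisRep (p : ℤ))
    {M' : Type} [AddCommGroup M'] [TopologicalSpace M'] [DiscreteTopology M'] [Finite M']
    (ρ' : DiscreteGaloisModule ℚ M')
    (hker : ∀ u : absoluteGaloisGroup ℚ, ρ' u = 1 → W.torsionGaloisModule (p : ℤ) u = 1)
    {N' : ℕ} (hN' : N' ≠ 0) (S : Set (HeightOneSpectrum (𝓞 ℚ))) (hS : S.Finite)
    {τ : absoluteGaloisGroup ℚ} (hτ : Nonempty (cokerSubOne (W.torsionGaloisModule (p : ℤ)) τ ≃+ ZMod p))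
    (hH3 : ∀ f : contOneCocycles (W.torsionGaloisModule (p : ℤ)).toTopRep,
      (∀ u : absoluteGaloisGroup ℚ, ρ' u = 1 → u ∈ rootsOfUnityFixer ℚ N' → f.1 u = 0) →
        oneCocycleClass (W.torsionGaloisModule (p : ℤ)).toTopRep f = 0)
    (c₁ c₂ c₃ c₄ : galoisCohomology (W.torsionGaloisModule (p : ℤ)) 1)
    (hind : ∀ a : Fin 3 → ZMod p, (∑ i, (a i).val • ![c₁, c₂, c₃] i) = 0 → a = 0) (hc₄ : c₄ ≠ 0) :
    {q | q ∈ frobeniusClassPrimes ρ' S τ N' ∧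
      galoisCohomology.localization (W.torsionGaloisModule (p : ℤ)) (Sum.inr q) 1 c₁ ≠ 0 ∧
      galoisCohomology.localization (W.torsionGaloisModule (p : ℤ)) (Sum.inr q) 1 c₂ ≠ 0 ∧
      galoisCohomology.localization (W.torsionGaloisModule (p : ℤ)) (Sum.inr q) 1 c₃ ≠ 0 ∧
      galoisCohomology.localization (W.torsionGaloisModule (p : ℤ)) (Sum.inr q) 1 c₄ ≠ 0}.Infinite := by
  have hp : p.Prime := Fact.out
  haveI : NeZero (p : ℚ) := ⟨Nat.cast_ne_zero.mpr hp.ne_zero⟩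
  haveI : Finite (geomTorsion W (p : ℤ)) :=
    finite_torsionPoints_holds W (AlgebraicClosure ℚ) (by exact_mod_cast hp.ne_zero)
  have hp3 : 3 ≤ p := by
    rcases hp.eq_two_or_odd' with h | h
    · exact absurd h hp2
    · have := hp.two_le; omega
  have hirr := hasIrreducibleModPGaloisRep_of_hasSurjectiveModNGaloisRep W p hsurj
  exact infinite_setOf_mem_frobeniusClassPrimes_localization_ne_zero_four_deep
    (W.torsionGaloisModule (p : ℤ)) ρ' hker hp3 hN' S hS hτ
    (fun A hA => hirr A fun σ P hP => hA σ P hP) hH3 c₁ c₂ c₃ c₄ hind hc₄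

/-- **The `hL52` supply for an `E[3]`-datum with DEEP primes `frobeniusClassPrimes (E[3^{k′}·3]) S τ 3^{k′+1}`,
NO hypothesis beyond `E[3]` irreducible** ((H.3′) on the deep group is the tree theorem
`hH3_three_pow_of_irr`; `ker ρ_{E[3^{k′+1}]} ≤ ker ρ_{E[3]}` by `S24Deep.torsionGaloisModule_eq_one_of_dvd`):
with `ρ̄_{E,3}` onto, for `c₁, c₂, c₃` independent in `H¹(ℚ, E[3])` and `c₄ ≠ 0` there are infinitely
many deep primes `𝔮` with `loc_𝔮 cⱼ ≠ 0`, `j = 1, …, 4`. [cite: Sakamoto2024, Lemma 5.2 (p. 928) and Lemma 6.4 (pp. 931–932)]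
[cite: MazurRubin2004, §3.5 (H.5) (p. 27) and Prop. A.2 (pp. 79–80)] -/
theorem hL52_three_deep_of_hasSurjectiveModNGaloisRep [Finite (geomTorsion W ((3 : ℕ) : ℤ))]
    (h3 : W.HasSurjectiveModNGaloisRep ((3 : ℕ) : ℤ)) (k' : ℕ)
    (S : Set (HeightOneSpectrum (𝓞 ℚ))) (hS : S.Finite) {τ : absoluteGaloisGroup ℚ}
    (hτ : Nonempty (cokerSubOne (W.torsionGaloisModule ((3 : ℕ) : ℤ)) τ ≃+ ZMod 3)) :
    ∀ c₁ c₂ c₃ c₄ : galoisCohomology (W.torsionGaloisModule ((3 : ℕ) : ℤ)) 1,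
      (∀ a : Fin 3 → ZMod 3, (∑ i, (a i).val • ![c₁, c₂, c₃] i) = 0 → a = 0) → c₄ ≠ 0 →
      {q | q ∈ frobeniusClassPrimes (W.torsionGaloisModule (((3 : ℕ) : ℤ) ^ k' * ((3 : ℕ) : ℤ))) S τ
          (3 ^ (k' + 1)) ∧
        galoisCohomology.localization (W.torsionGaloisModule ((3 : ℕ) : ℤ)) (Sum.inr q) 1 c₁ ≠ 0 ∧
        galoisCohomology.localization (W.torsionGaloisModule ((3 : ℕ) : ℤ)) (Sum.inr q) 1 c₂ ≠ 0 ∧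
        galoisCohomology.localization (W.torsionGaloisModule ((3 : ℕ) : ℤ)) (Sum.inr q) 1 c₃ ≠ 0 ∧
        galoisCohomology.localization (W.torsionGaloisModule ((3 : ℕ) : ℤ)) (Sum.inr q) 1 c₄ ≠ 0}.Infinite := by
  haveI : Fact (Nat.Prime 3) := ⟨Nat.prime_three⟩
  intro c₁ c₂ c₃ c₄ hind hc₄
  haveI : Finite (geomTorsion W (((3 : ℕ) : ℤ) ^ k' * ((3 : ℕ) : ℤ))) := finite_geomTorsion_pow_mul W 3 k'
  have hker : ∀ u : absoluteGaloisGroup ℚ,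
      W.torsionGaloisModule (((3 : ℕ) : ℤ) ^ k' * ((3 : ℕ) : ℤ)) u = 1 →
        W.torsionGaloisModule ((3 : ℕ) : ℤ) u = 1 :=
    fun u hu => S24Deep.torsionGaloisModule_eq_one_of_dvd W (Dvd.intro_left _ rfl) u hu
  exact infinite_setOf_mem_frobeniusClassPrimes_localization_ne_zero_torsion_four_deep W 3 (by decide) h3
    (W.torsionGaloisModule (((3 : ℕ) : ℤ) ^ k' * ((3 : ℕ) : ℤ))) hker (pow_ne_zero _ three_ne_zero) S hS
    hτ (hH3_three_pow_of_irr W (hasIrreducibleModPGaloisRep_of_hasSurjectiveModNGaloisRep W 3 h3) k')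
    c₁ c₂ c₃ c₄ hind hc₄

end Torsion

end Summit.BirchSwinnertonDyer.BirchSwinnertonDyer.Theorems.KimAtThreeDeepLowerS24DeepPrimeChoice

end
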